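import Summits.QuantumFields.YangMills.Theorems.BalabanUVNodesN07LocalLettersCoreGuardedB
import HarnessLib

/-!
# BalabanUVNodes ∕ N07 — THE GUARDED S6 TOKENS OVER `(bd, Dat, Ex0)`, PART 2: THE PER-DATUM TOKENS `DatumGauge165TopStepCoreGB ∕ DatumGaugeSplitTopStepCoreGB`, their
# ∃-introduction into PART 1's `LocalLetters165TopStepCoreGB ∕ LocalLettersSplitTopStepCoreGB`, the compositions into F0c's `HalvingStepTopCoreGB`, and the `floorGuard` bridges —
# row S1c-0 of the (E1)∕(iii-b) work plan (director-ym №338∕№339∕№341; FLAG №16; LOCATE-HSEAM 5d3298b8d191f169)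

Cell `pub-ymgap`, width seat `pub-ymgap-dag-n07-w3` g15 (CLAIM S1c-0, bus 2026-08-30 07:55:57Z; owner slot dag-n07-e lineage).  `--kind definition --supports stmt-QuantumFields-20541`
(K0⁷; count-neutral).  PURELY ADDITIVE — «print-datum parametrisation of `Summits/…/BalabanUVNodesN07LocalLettersCoreGuarded` (FLAG №16 ∕ LOCATE-HSEAM 5d3298b8d191f169); the
(b)-instances `LocalLetters165TopStepCoreG ∕ LocalLettersSplitTopStepCoreG ∕ DatumGauge165TopStepCoreG ∕ DatumGaugeSplitTopStepCoreG` stay landed and true on their own text»; no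
displayed premise of any token is deleted or weakened — the data row, the two fibre rows and the level-0 plaquette exclusion become PARAMETERS, and dag-n07-w4's tokens are the
instance `(genSetDatum F, dataSmall7PTopOf F N, printedPlaqs0Of F)` by `Iff.rfl`.  [15] = [Balaban1985Variational]; [6] = [Balaban1985RegularSpaces]; [II] = [Balaban1984PropagatorsII];
[III] = [Balaban1988Convergent]; [I] = [Balaban1987RG1].

WHY.  dag-n07-w4's module `…N07LocalLettersCoreGuarded` carries the S6 head's four interface tokens with the guard slot `Adm : StepGuard F` (n07-e's module-47 pattern) and their
compositions into module 47's `HalvingStepTopCoreG`.  Each token displays the data row `Sect2.DataSmall7PTop (avOfRecord F N K) s.Ω (Sup ν K s.Ω) k δ W` and the fibre rows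
`AgreeOn (genSet s.Ω k) (Ū U) W → IsCritOnFibre F N K (genSet s.Ω k) W U` — READING (b) of [III] (2.2)'s determining set — and the two core tokens display the level-0 plaquette
exclusion `p ∉ Sect2.printedPlaqs s.Ω k 0`.  Exactly as F0c (`Node00/CriticalOnFibreTopGuardedB`, ✓p765717) did for module 47, THIS FILE makes those rows parameters
`(bd : BondDatum F) (Dat : TopData F N) (Ex0 : PlaqRange0 F)`, so that the print datum `bd := lamDatum F` ([II] (2.3)'s `Λ_j`, ruling (α)) is an INSTANCE and the chart road's twins
(S1c: `…TowerW152E′`, …) and n07-w2's S1b-2 can compose by name.  Every composition is POINTWISE in `(W, U)` and merely THREADS the rows, so the proofs are dag-n07-w4's terms.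

CONTENTS (this part: §3–§5; PART 1 `…N07LocalLettersCoreGuardedB` holds §0–§2).  §1–§4 the four `…GB` tokens, each with ★ `…G_iff_GB` (`Iff.rfl` at the (b)-instance), `.of_le` (ceilings), `.of_imp` (guard), `.of_imp_dat` (data predicate), the core pair also
`.of_subset_ex0` (exclusion range); ★★ `halvingStepTopCoreGB_of_localLetters165CoreGB ∕ …SplitCoreGB` (same thresholds as the parents), ★★★ `localLetters165CoreGB_of_datumGauge165CoreGB ∕
localLettersSplitCoreGB_of_datumGaugeSplitCoreGB` (the ∃-introduction of the S6 head, at `Ex0 := printedPlaqs0Of F` — the core level is read off print's level-0 exclusion — and, by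
`.of_subset_ex0`, at every larger range), ★★ `halvingStepTopCoreGB_of_datumGauge165CoreGB ∕ …SplitCoreGB`; §5 the four `…R_iff_GB_floorGuard` bridges to dag-n07-w4's floor editions
(definitional).
HONEST FRAMING: definitions of named facts (displayed `Prop`s, NEVER asserted) + binder-threading bookkeeping; NOTHING of Bałaban's analysis proved; no (b)-instance token claimed false
(FLAG №16 concerns which instance print PROVES; the kernel certificate `…N07SeamNotInhabited.not_hseam` concerns the (b)→(2.3) seam, not these tokens); K0⁷ stub 1 NOT closed; N05 ∕ N07
NOT discharged; counts unmoved (typed 28∕28 · discharged 8∕28); R4 = the conditional finite-𝕋⁴ rung `BalabanLadder.UV` ONLY; the YM mass gap (Clay) is NOT proved by any of this; nothing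
continuum ∕ ℝ⁴ ∕ OS.  Two `def`s here (two in PART 1), no `instance`, no `notation`, no `sorry`.

References: [15] (7) p.278, (144) p.300, (152) p.301, (159) p.303, (162)–(168) pp.303–304, Prop. 8 p.304; [6] (1.2) p.76, (1.3)–(1.9) p.77, (1.54) p.85; [II] (2.3) p.224;
[III] (2.2) p.255, (2.10)–(2.12) p.256; [I] (0.1) p.251, (1.1) p.260.
-/

noncomputable section

namespace Summit.QuantumFields.YangMills.BalabanUVNodes.N07LocalLettersCoreGuardedB

open scoped Matrix.Norms.L2Operator
open Literature.MathematicalPhysics.QuantumFieldTheory.Balaban1983to89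
open Literature.MathematicalPhysics.QuantumFieldTheory.Balaban1983to89.Node00
open Literature.MathematicalPhysics.QuantumFieldTheory.Balaban1983to89.T4Continuum (T4Family)
open Literature.MathematicalPhysics.QuantumFieldTheory.Balaban1983to89.B15DeterminingSets
open Literature.MathematicalPhysics.QuantumFieldTheory.Balaban1983to89.B15DeterminingSetsB
open B15Eq112TorusCover (cover lift)
open B14DomainGeom (Pt Within cubeIdx)
open B14.Eq213MaximalDomains (side cubeExt)
open B8Eq131Cubes (box)
open Summit.QuantumFields.YangMills.BalabanUVNodes.N07HalvingStepTopOfLocalLetters (radius_descend threshold167_of_budget165)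
open Summit.QuantumFields.YangMills.BalabanUVNodes.N07LocalLettersCoreOfDatumGauges (mem_cubeExt_cubeIdx exists_within_three_of_mem_plaqsOf
  exists_within_three_of_not_mem_bondsDeep_compl)
open Summit.QuantumFields.YangMills.BalabanUVNodes.N07LocalLettersSplitCore (LocalGaugeSplitOn regularTwo_of_localGaugeSplitOn thresholdSplit_plaq thresholdSplit_bond)
open Summit.QuantumFields.YangMills.BalabanUVNodes.N07LocalLettersCoreFloor
open Summit.QuantumFields.YangMills.BalabanUVNodes.N07LocalLettersCoreGuarded


/-! ## §3  The per-datum (165)-token over `(bd, Dat)` and its reduction -/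

section Datum165B

variable (F : T4Family) (N : ℕ) [NeZero N]

/-- **[15] (165) PER DATA CUBE — GUARDED TOKEN OVER `(bd, Dat)`**: dag-n07-w4's `DatumGauge165TopStepCoreG` with the data row and the fibre rows parametrised (no level-0 exclusion occurs
in the per-datum form).  Print-datum parametrisation of `DatumGauge165TopStepCoreG` (FLAG №16 ∕ LOCATE-HSEAM 5d3298b8d191f169); the (b)-instance stays landed and true on its own text
(`datumGauge165TopStepCoreG_iff_GB`).  A `Prop`, NEVER asserted. [cite: Balaban1985Variational, (165) p.304, (144) p.300, p.302; Balaban1984PropagatorsII, (2.3) p.224] -/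
def DatumGauge165TopStepCoreGB (Sup : (ν : Stage7Numerics) → (K : ℕ) → (ℕ → Set (Site (F.P K) 0)) → Set (Site (F.P K) 0)) (Mc ρ : ℕ) (Adm : StepGuard F) (bd : BondDatum F)
    (Dat : TopData F N) (B₃ C θ Q a₀ a₁ : ℝ) : Prop :=
  ∀ (ν : Stage7Numerics) (M : ℕ) (g : ℕ → ℝ) (K k : ℕ) (s : SeqOfRecord F ν M g K k), Sect2.SeqSeparated ν.M₁ s → 0 < ν.M₁ → Adm ν M g K k s → 1 ≤ k →
    ∀ (ε δ : ℕ → ℝ),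
    (∀ n, n ≤ k → 0 < δ n ∧ δ n ≤ a₁) → (∀ n, n < k → δ n ≤ 2 * δ (n + 1)) → (∀ n, n < k → δ (n + 1) ≤ 2 * δ n) →
    (∀ n, n ≤ k → B₃ * δ n ≤ ε n ∧ ε n ≤ a₀) → (∀ n, n < k → ε n ≤ 2 * ε (n + 1)) → (∀ n, n < k → ε (n + 1) ≤ 2 * ε n) →
    ∀ W : MSField (F.P K) (SU N), Dat K s.Ω (Sup ν K s.Ω) k δ W →
      ∀ U : GaugeField (F.P K) 0 (SU N),
        (∀ n, n ≤ k → PlaqSmallOn (Sect2.omegaPlaqsTop s.Ω (Sup ν K s.Ω) n) (ε n * (F.P K).eta n ^ 2) U) →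
        (∀ n, n ≤ k → Sect2.CoDivSmallOn (Sect2.omegaBondsTop s.Ω (Sup ν K s.Ω) n) (ε n * (F.P K).eta n ^ 3) U) →
        AgreeOnB (bd K k s.Ω) (avgFamily (avOfRecord F N K) U) W →
        IsCritOnFibreB F N K (bd K k s.Ω) W U →
        ∀ j, 1 ≤ j → j ≤ k → ∀ a : Pt (F.P K).d,
          (∃ x y : Pt (F.P K).d, x ∈ cubeExt (side (F.P K).L Mc j) a 0 ∧ cover (F.P K) y ∈ s.Ω j ∧ Within ((3 : ℕ) : ℤ) x y) →
          Sect2.LocalGauge10On (cover (F.P K) '' box (F.P K).L (cornerP (F.P K) Mc ρ a) (sideP (F.P K) Mc ρ) j)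
            ((F.P K).eta j) (C * δ j + θ * ε j + Q * ε j ^ 2) U

variable {F N}

/-- ★ dag-n07-w4's `DatumGauge165TopStepCoreG` IS the instance `(genSetDatum F) (dataSmall7PTopOf F N)`, definitionally. [cite: Balaban1985Variational, (165) p.304; Balaban1988Convergent, (2.10) p.256] -/
theorem datumGauge165TopStepCoreG_iff_GB {Sup : (ν : Stage7Numerics) → (K : ℕ) → (ℕ → Set (Site (F.P K) 0)) → Set (Site (F.P K) 0)} {Mc ρ : ℕ} {Adm : StepGuard F} {B₃ C θ Q a₀ a₁ : ℝ} :
    DatumGauge165TopStepCoreG F N Sup Mc ρ Adm B₃ C θ Q a₀ a₁ ↔ DatumGauge165TopStepCoreGB F N Sup Mc ρ Adm (genSetDatum F) (dataSmall7PTopOf F N) B₃ C θ Q a₀ a₁ :=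
  Iff.rfl

/-- Monotone in the guard. [cite: Balaban1985Variational, (144) p.300 (bookkeeping)] -/
theorem DatumGauge165TopStepCoreGB.of_imp {Sup : (ν : Stage7Numerics) → (K : ℕ) → (ℕ → Set (Site (F.P K) 0)) → Set (Site (F.P K) 0)} {Mc ρ : ℕ} {Adm Adm' : StepGuard F} {bd : BondDatum F} {Dat : TopData F N}
    {B₃ C θ Q a₀ a₁ : ℝ} (h : DatumGauge165TopStepCoreGB F N Sup Mc ρ Adm bd Dat B₃ C θ Q a₀ a₁) (himp : ∀ ν M g K k s, Adm' ν M g K k s → Adm ν M g K k s) :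
    DatumGauge165TopStepCoreGB F N Sup Mc ρ Adm' bd Dat B₃ C θ Q a₀ a₁ :=
  fun ν M g K k s hsep hM₁ hc' hk => h ν M g K k s hsep hM₁ (himp ν M g K k s hc') hk

/-- Antitone in the data predicate. [cite: Balaban1985Variational, (7) p.278 (bookkeeping)] -/
theorem DatumGauge165TopStepCoreGB.of_imp_dat {Sup : (ν : Stage7Numerics) → (K : ℕ) → (ℕ → Set (Site (F.P K) 0)) → Set (Site (F.P K) 0)} {Mc ρ : ℕ} {Adm : StepGuard F} {bd : BondDatum F} {Dat Dat' : TopData F N}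
    {B₃ C θ Q a₀ a₁ : ℝ} (h : DatumGauge165TopStepCoreGB F N Sup Mc ρ Adm bd Dat B₃ C θ Q a₀ a₁)
    (himp : ∀ (K : ℕ) (Ω : ℕ → Set (Site (F.P K) 0)) (Ω₀ : Set (Site (F.P K) 0)) (k : ℕ) (δ : ℕ → ℝ) (W : MSField (F.P K) (SU N)), Dat' K Ω Ω₀ k δ W → Dat K Ω Ω₀ k δ W) :
    DatumGauge165TopStepCoreGB F N Sup Mc ρ Adm bd Dat' B₃ C θ Q a₀ a₁ :=
  fun ν M g K k s hsep hM₁ hc hk ε δ hδ hcomp hcomp' hε hεcomp hεcomp' W h7 =>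
    h ν M g K k s hsep hM₁ hc hk ε δ hδ hcomp hcomp' hε hεcomp hεcomp' W (himp _ _ _ _ _ _ h7)

/-- ★★★ **THE ∃-INTRODUCTION OF THE S6 HEAD OVER `(bd, Dat)`** (dag-n07-w4's `localLetters165CoreG_of_datumGauge165CoreG` with the rows threaded): for `Mc ≥ 1`, `ρ ≥ L`, the per-datum token
gives the per-plaquette ∕ per-bond token at print's level-0 exclusion `Ex0 := printedPlaqs0Of F` (the core level of a plaquette is read off `p ∉ Sect2.printedPlaqs s.Ω k 0`; every larger range
by `.of_subset_ex0`). [cite: Balaban1985Variational, p.304, p.302, (165) p.304; Balaban1985RegularSpaces, (1.7)–(1.9) p.77, (1.2) p.76] -/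
theorem localLetters165CoreGB_of_datumGauge165CoreGB {Sup : (ν : Stage7Numerics) → (K : ℕ) → (ℕ → Set (Site (F.P K) 0)) → Set (Site (F.P K) 0)}
    {Mc ρ : ℕ} {Adm : StepGuard F} {bd : BondDatum F} {Dat : TopData F N} (hMc : 1 ≤ Mc) (hρ : F.L ≤ ρ) {B₃ C θ Q a₀ a₁ : ℝ}
    (h : DatumGauge165TopStepCoreGB F N Sup Mc ρ Adm bd Dat B₃ C θ Q a₀ a₁) :
    LocalLetters165TopStepCoreGB F N Sup Adm bd Dat (printedPlaqs0Of F) B₃ C θ Q a₀ a₁ := by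
  intro ν M g K k s hsep hM₁ hc hk ε δ hδ hcomp hcomp' hε hεcomp hεcomp' W h7 U h17 h19 hfib hcrit m hm
  have hD := h ν M g K k s hsep hM₁ hc hk ε δ hδ hcomp hcomp' hε hεcomp hεcomp' W h7 U h17 h19 hfib hcrit
  have hρK : (F.P K).L ≤ ρ := hρ
  have hS : ∀ j, 0 < side (F.P K).L Mc j := fun j => B14.Eq213MaximalDomains.side_pos (F.P K).L_pos hMc j
  refine ⟨fun p hp hcore => ?_, fun b hb hcore => ?_⟩
  · obtain ⟨j, hmj, hjk, hpj⟩ := Sect2.exists_level_of_core_plaq hk hm hp hcore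
    have hj : 1 ≤ j := le_trans (le_max_right m 1) hmj
    obtain ⟨y, hy, hxy⟩ := exists_within_three_of_mem_plaqsOf hpj
    have hg := hD j hj hjk (cubeIdx (side (F.P K).L Mc j) (lift (F.P K) p.src))
      ⟨lift (F.P K) p.src, y, mem_cubeExt_cubeIdx (hS j) _, hy, hxy⟩
    exact ⟨_, j, le_trans (le_max_left m 1) hmj, hjk, Sect2.mem_plaqInside_cover_box_propCubeP p hj hMc hρK, hg⟩
  · obtain ⟨j, hmj, hjk, hbj⟩ := Sect2.exists_level_of_core_bond hk hm hb hcore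
    have hj : 1 ≤ j := le_trans (le_max_right m 1) hmj
    obtain ⟨y, hy, hxy⟩ := exists_within_three_of_not_mem_bondsDeep_compl hbj
    have hg := hD j hj hjk (cubeIdx (side (F.P K).L Mc j) (lift (F.P K) b.src - fun _ => 1))
      ⟨lift (F.P K) b.src - fun _ => 1, y, mem_cubeExt_cubeIdx (hS j) _, hy, hxy⟩
    exact ⟨_, j, le_trans (le_max_left m 1) hmj, hjk, Sect2.mem_bondsDeep_cover_box_propCubeP b hj hMc hρK, hg⟩

/-- The same at any exclusion range containing print's level-0 range. [cite: Balaban1985Variational, (7) p.278, p.304 (bookkeeping)] -/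
theorem localLetters165CoreGB_of_datumGauge165CoreGB_of_subset_ex0 {Sup : (ν : Stage7Numerics) → (K : ℕ) → (ℕ → Set (Site (F.P K) 0)) → Set (Site (F.P K) 0)}
    {Mc ρ : ℕ} {Adm : StepGuard F} {bd : BondDatum F} {Dat : TopData F N} {Ex0 : PlaqRange0 F} (hMc : 1 ≤ Mc) (hρ : F.L ≤ ρ) {B₃ C θ Q a₀ a₁ : ℝ}
    (h : DatumGauge165TopStepCoreGB F N Sup Mc ρ Adm bd Dat B₃ C θ Q a₀ a₁) (hsub : ∀ (K k : ℕ) (Ω : ℕ → Set (Site (F.P K) 0)), printedPlaqs0Of F K k Ω ⊆ Ex0 K k Ω) :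
    LocalLetters165TopStepCoreGB F N Sup Adm bd Dat Ex0 B₃ C θ Q a₀ a₁ :=
  (localLetters165CoreGB_of_datumGauge165CoreGB hMc hρ h).of_subset_ex0 hsub

/-- ★★ **THE PER-DATUM (165)-GAUGES OVER `(bd, Dat)` CLOSE THE ONE-STEP IMPROVEMENT OVER `(bd, Dat, printedPlaqs0Of)`** (composition with §1).
[cite: Balaban1985Variational, (165)–(168) p.304, (162)–(163) pp.303–304, Prop. 8 p.304; Balaban1985RegularSpaces, (1.7)–(1.9) p.77] -/
theorem halvingStepTopCoreGB_of_datumGauge165CoreGB {Sup : (ν : Stage7Numerics) → (K : ℕ) → (ℕ → Set (Site (F.P K) 0)) → Set (Site (F.P K) 0)}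
    {Mc ρ : ℕ} {Adm : StepGuard F} {bd : BondDatum F} {Dat : TopData F N} (hMc : 1 ≤ Mc) (hρ : F.L ≤ ρ) {B₃ C θ Q a₀ a₁ : ℝ}
    (h : DatumGauge165TopStepCoreGB F N Sup Mc ρ Adm bd Dat B₃ C θ Q a₀ a₁)
    (hB₃ : 0 ≤ B₃) (hC : 128 * C ≤ B₃) (hθ' : 512 * θ ≤ 1) (hQ : 0 ≤ Q) (ha : 512 * Q * a₀ ≤ 1) (ha₀ : 2 * a₀ ≤ 1) :
    HalvingStepTopCoreGB F N Sup Adm bd Dat (printedPlaqs0Of F) B₃ a₀ a₁ :=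
  halvingStepTopCoreGB_of_localLetters165CoreGB (localLetters165CoreGB_of_datumGauge165CoreGB hMc hρ h) hB₃ hC hθ' hQ ha ha₀

end Datum165B

/-! ## §4  The per-datum split token over `(bd, Dat)` and its reduction -/

section DatumSplitB

variable (F : T4Family) (N : ℕ) [NeZero N]

/-- **[15] (165) PER DATA CUBE, SPLIT GAUGE, ROAD R0′ — GUARDED TOKEN OVER `(bd, Dat)`**: dag-n07-w4's `DatumGaugeSplitTopStepCoreG` with the data row and the fibre rows parametrised.
Print-datum parametrisation of `DatumGaugeSplitTopStepCoreG` (FLAG №16 ∕ LOCATE-HSEAM 5d3298b8d191f169); the (b)-instance stays landed and true on its own text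
(`datumGaugeSplitTopStepCoreG_iff_GB`).  A `Prop`, NEVER asserted. [cite: Balaban1985Variational, (165) p.304, (144) p.300, (152) p.301, (159) p.303; Balaban1984PropagatorsII, (2.3) p.224] -/
def DatumGaugeSplitTopStepCoreGB (Sup : (ν : Stage7Numerics) → (K : ℕ) → (ℕ → Set (Site (F.P K) 0)) → Set (Site (F.P K) 0)) (Mc ρ : ℕ) (Adm : StepGuard F) (bd : BondDatum F)
    (Dat : TopData F N) (B₃ C θ Q κ a₀ a₁ : ℝ) : Prop :=
  ∀ (ν : Stage7Numerics) (M : ℕ) (g : ℕ → ℝ) (K k : ℕ) (s : SeqOfRecord F ν M g K k), Sect2.SeqSeparated ν.M₁ s → 0 < ν.M₁ → Adm ν M g K k s → 1 ≤ k →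
    ∀ (ε δ : ℕ → ℝ),
    (∀ n, n ≤ k → 0 < δ n ∧ δ n ≤ a₁) → (∀ n, n < k → δ n ≤ 2 * δ (n + 1)) → (∀ n, n < k → δ (n + 1) ≤ 2 * δ n) →
    (∀ n, n ≤ k → B₃ * δ n ≤ ε n ∧ ε n ≤ a₀) → (∀ n, n < k → ε n ≤ 2 * ε (n + 1)) → (∀ n, n < k → ε (n + 1) ≤ 2 * ε n) →
    ∀ W : MSField (F.P K) (SU N), Dat K s.Ω (Sup ν K s.Ω) k δ W →
      ∀ U : GaugeField (F.P K) 0 (SU N),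
        (∀ n, n ≤ k → PlaqSmallOn (Sect2.omegaPlaqsTop s.Ω (Sup ν K s.Ω) n) (ε n * (F.P K).eta n ^ 2) U) →
        (∀ n, n ≤ k → Sect2.CoDivSmallOn (Sect2.omegaBondsTop s.Ω (Sup ν K s.Ω) n) (ε n * (F.P K).eta n ^ 3) U) →
        AgreeOnB (bd K k s.Ω) (avgFamily (avOfRecord F N K) U) W →
        IsCritOnFibreB F N K (bd K k s.Ω) W U →
        ∀ j, 1 ≤ j → j ≤ k → ∀ a : Pt (F.P K).d,
          (∃ x y : Pt (F.P K).d, x ∈ cubeExt (side (F.P K).L Mc j) a 0 ∧ cover (F.P K) y ∈ s.Ω j ∧ Within ((3 : ℕ) : ℤ) x y) →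
          LocalGaugeSplitOn (cover (F.P K) '' box (F.P K).L (cornerP (F.P K) Mc ρ a) (sideP (F.P K) Mc ρ) j)
            ((F.P K).eta j) (κ * ε j) (C * δ j + θ * ε j + Q * ε j ^ 2) U

variable {F N}

/-- ★ dag-n07-w4's `DatumGaugeSplitTopStepCoreG` IS the instance `(genSetDatum F) (dataSmall7PTopOf F N)`, definitionally. [cite: Balaban1985Variational, (165) p.304; Balaban1988Convergent, (2.10) p.256] -/
theorem datumGaugeSplitTopStepCoreG_iff_GB {Sup : (ν : Stage7Numerics) → (K : ℕ) → (ℕ → Set (Site (F.P K) 0)) → Set (Site (F.P K) 0)} {Mc ρ : ℕ} {Adm : StepGuard F} {B₃ C θ Q κ a₀ a₁ : ℝ} :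
    DatumGaugeSplitTopStepCoreG F N Sup Mc ρ Adm B₃ C θ Q κ a₀ a₁ ↔ DatumGaugeSplitTopStepCoreGB F N Sup Mc ρ Adm (genSetDatum F) (dataSmall7PTopOf F N) B₃ C θ Q κ a₀ a₁ :=
  Iff.rfl

/-- Monotone in the guard. [cite: Balaban1985Variational, (144) p.300 (bookkeeping)] -/
theorem DatumGaugeSplitTopStepCoreGB.of_imp {Sup : (ν : Stage7Numerics) → (K : ℕ) → (ℕ → Set (Site (F.P K) 0)) → Set (Site (F.P K) 0)} {Mc ρ : ℕ} {Adm Adm' : StepGuard F} {bd : BondDatum F} {Dat : TopData F N}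
    {B₃ C θ Q κ a₀ a₁ : ℝ} (h : DatumGaugeSplitTopStepCoreGB F N Sup Mc ρ Adm bd Dat B₃ C θ Q κ a₀ a₁) (himp : ∀ ν M g K k s, Adm' ν M g K k s → Adm ν M g K k s) :
    DatumGaugeSplitTopStepCoreGB F N Sup Mc ρ Adm' bd Dat B₃ C θ Q κ a₀ a₁ :=
  fun ν M g K k s hsep hM₁ hc' hk => h ν M g K k s hsep hM₁ (himp ν M g K k s hc') hk

/-- Antitone in the data predicate. [cite: Balaban1985Variational, (7) p.278 (bookkeeping)] -/
theorem DatumGaugeSplitTopStepCoreGB.of_imp_dat {Sup : (ν : Stage7Numerics) → (K : ℕ) → (ℕ → Set (Site (F.P K) 0)) → Set (Site (F.P K) 0)} {Mc ρ : ℕ} {Adm : StepGuard F} {bd : BondDatum F} {Dat Dat' : TopData F N}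
    {B₃ C θ Q κ a₀ a₁ : ℝ} (h : DatumGaugeSplitTopStepCoreGB F N Sup Mc ρ Adm bd Dat B₃ C θ Q κ a₀ a₁)
    (himp : ∀ (K : ℕ) (Ω : ℕ → Set (Site (F.P K) 0)) (Ω₀ : Set (Site (F.P K) 0)) (k : ℕ) (δ : ℕ → ℝ) (W : MSField (F.P K) (SU N)), Dat' K Ω Ω₀ k δ W → Dat K Ω Ω₀ k δ W) :
    DatumGaugeSplitTopStepCoreGB F N Sup Mc ρ Adm bd Dat' B₃ C θ Q κ a₀ a₁ :=
  fun ν M g K k s hsep hM₁ hc hk ε δ hδ hcomp hcomp' hε hεcomp hεcomp' W h7 =>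
    h ν M g K k s hsep hM₁ hc hk ε δ hδ hcomp hcomp' hε hεcomp hεcomp' W (himp _ _ _ _ _ _ h7)

/-- ★★★ **THE ∃-INTRODUCTION OF THE S6 HEAD OVER `(bd, Dat)`, SPLIT EDITION** (dag-n07-w4's `localLettersSplitCoreG_of_datumGaugeSplitCoreG` with the rows threaded), at print's level-0
exclusion `printedPlaqs0Of F`. [cite: Balaban1985Variational, p.304, p.302, (165) p.304; Balaban1985RegularSpaces, (1.7)–(1.9) p.77, (1.2) p.76] -/
theorem localLettersSplitCoreGB_of_datumGaugeSplitCoreGB {Sup : (ν : Stage7Numerics) → (K : ℕ) → (ℕ → Set (Site (F.P K) 0)) → Set (Site (F.P K) 0)}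
    {Mc ρ : ℕ} {Adm : StepGuard F} {bd : BondDatum F} {Dat : TopData F N} (hMc : 1 ≤ Mc) (hρ : F.L ≤ ρ) {B₃ C θ Q κ a₀ a₁ : ℝ}
    (h : DatumGaugeSplitTopStepCoreGB F N Sup Mc ρ Adm bd Dat B₃ C θ Q κ a₀ a₁) :
    LocalLettersSplitTopStepCoreGB F N Sup Adm bd Dat (printedPlaqs0Of F) B₃ C θ Q κ a₀ a₁ := by
  intro ν M g K k s hsep hM₁ hc hk ε δ hδ hcomp hcomp' hε hεcomp hεcomp' W h7 U h17 h19 hfib hcrit m hm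
  have hD := h ν M g K k s hsep hM₁ hc hk ε δ hδ hcomp hcomp' hε hεcomp hεcomp' W h7 U h17 h19 hfib hcrit
  have hρK : (F.P K).L ≤ ρ := hρ
  have hS : ∀ j, 0 < side (F.P K).L Mc j := fun j => B14.Eq213MaximalDomains.side_pos (F.P K).L_pos hMc j
  refine ⟨fun p hp hcore => ?_, fun b hb hcore => ?_⟩
  · obtain ⟨j, hmj, hjk, hpj⟩ := Sect2.exists_level_of_core_plaq hk hm hp hcore
    have hj : 1 ≤ j := le_trans (le_max_right m 1) hmj
    obtain ⟨y, hy, hxy⟩ := exists_within_three_of_mem_plaqsOf hpj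
    have hg := hD j hj hjk (cubeIdx (side (F.P K).L Mc j) (lift (F.P K) p.src))
      ⟨lift (F.P K) p.src, y, mem_cubeExt_cubeIdx (hS j) _, hy, hxy⟩
    exact ⟨_, j, le_trans (le_max_left m 1) hmj, hjk, Sect2.mem_plaqInside_cover_box_propCubeP p hj hMc hρK, hg⟩
  · obtain ⟨j, hmj, hjk, hbj⟩ := Sect2.exists_level_of_core_bond hk hm hb hcore
    have hj : 1 ≤ j := le_trans (le_max_right m 1) hmj
    obtain ⟨y, hy, hxy⟩ := exists_within_three_of_not_mem_bondsDeep_compl hbj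
    have hg := hD j hj hjk (cubeIdx (side (F.P K).L Mc j) (lift (F.P K) b.src - fun _ => 1))
      ⟨lift (F.P K) b.src - fun _ => 1, y, mem_cubeExt_cubeIdx (hS j) _, hy, hxy⟩
    exact ⟨_, j, le_trans (le_max_left m 1) hmj, hjk, Sect2.mem_bondsDeep_cover_box_propCubeP b hj hMc hρK, hg⟩

/-- The same at any exclusion range containing print's level-0 range. [cite: Balaban1985Variational, (7) p.278, p.304 (bookkeeping)] -/
theorem localLettersSplitCoreGB_of_datumGaugeSplitCoreGB_of_subset_ex0 {Sup : (ν : Stage7Numerics) → (K : ℕ) → (ℕ → Set (Site (F.P K) 0)) → Set (Site (F.P K) 0)}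
    {Mc ρ : ℕ} {Adm : StepGuard F} {bd : BondDatum F} {Dat : TopData F N} {Ex0 : PlaqRange0 F} (hMc : 1 ≤ Mc) (hρ : F.L ≤ ρ) {B₃ C θ Q κ a₀ a₁ : ℝ}
    (h : DatumGaugeSplitTopStepCoreGB F N Sup Mc ρ Adm bd Dat B₃ C θ Q κ a₀ a₁) (hsub : ∀ (K k : ℕ) (Ω : ℕ → Set (Site (F.P K) 0)), printedPlaqs0Of F K k Ω ⊆ Ex0 K k Ω) :
    LocalLettersSplitTopStepCoreGB F N Sup Adm bd Dat Ex0 B₃ C θ Q κ a₀ a₁ :=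
  (localLettersSplitCoreGB_of_datumGaugeSplitCoreGB hMc hρ h).of_subset_ex0 hsub

/-- ★★ **THE PER-DATUM SPLIT GAUGES OVER `(bd, Dat)` CLOSE THE ONE-STEP IMPROVEMENT OVER `(bd, Dat, printedPlaqs0Of)`, ROAD R0′** (composition with §2).
[cite: Balaban1985Variational, (165)–(168) p.304, (162)–(163) pp.303–304, Prop. 8 p.304; Balaban1985RegularSpaces, (1.7)–(1.9) p.77, (1.54) p.85] -/
theorem halvingStepTopCoreGB_of_datumGaugeSplitCoreGB {Sup : (ν : Stage7Numerics) → (K : ℕ) → (ℕ → Set (Site (F.P K) 0)) → Set (Site (F.P K) 0)}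
    {Mc ρ : ℕ} {Adm : StepGuard F} {bd : BondDatum F} {Dat : TopData F N} (hMc : 1 ≤ Mc) (hρ : F.L ≤ ρ) {B₃ C θ Q κ a₀ a₁ : ℝ}
    (h : DatumGaugeSplitTopStepCoreGB F N Sup Mc ρ Adm bd Dat B₃ C θ Q κ a₀ a₁)
    (hB₃ : 0 ≤ B₃) (hC : 4 * C ≤ B₃) (hθ : 16 * θ ≤ 1) (hQ : 0 ≤ Q) (hκ : 0 ≤ κ) (ha : (16 * Q + 1024 * κ ^ 2) * a₀ ≤ 1)
    (hκa : 32 * κ * a₀ ≤ 1) : HalvingStepTopCoreGB F N Sup Adm bd Dat (printedPlaqs0Of F) B₃ a₀ a₁ :=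
  halvingStepTopCoreGB_of_localLettersSplitCoreGB (localLettersSplitCoreGB_of_datumGaugeSplitCoreGB hMc hρ h) hB₃ hC hθ hQ hκ ha hκa

end DatumSplitB

/-! ## §5  The `floorGuard` bridges from dag-n07-w4's floor editions to the (b)-instances of the `…GB` tokens (definitional) -/

section BridgesB

variable {F : T4Family} {N : ℕ} [NeZero N]

/-- `…R c ↔ …GB (floorGuard c) (genSetDatum, dataSmall7PTopOf, printedPlaqs0Of)` for the (165)-token. [cite: Balaban1985RegularSpaces, (1.3)–(1.6) p.77 (bookkeeping)] -/
theorem localLetters165TopStepCoreR_iff_GB_floorGuard {Sup : (ν : Stage7Numerics) → (K : ℕ) → (ℕ → Set (Site (F.P K) 0)) → Set (Site (F.P K) 0)} {c : ℕ}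
    {B₃ C θ Q a₀ a₁ : ℝ} : LocalLetters165TopStepCoreR F N Sup c B₃ C θ Q a₀ a₁ ↔
      LocalLetters165TopStepCoreGB F N Sup (floorGuard F c) (genSetDatum F) (dataSmall7PTopOf F N) (printedPlaqs0Of F) B₃ C θ Q a₀ a₁ :=
  Iff.rfl

/-- The same for the split token. [cite: Balaban1985RegularSpaces, (1.3)–(1.6) p.77 (bookkeeping)] -/
theorem localLettersSplitTopStepCoreR_iff_GB_floorGuard {Sup : (ν : Stage7Numerics) → (K : ℕ) → (ℕ → Set (Site (F.P K) 0)) → Set (Site (F.P K) 0)} {c : ℕ}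
    {B₃ C θ Q κ a₀ a₁ : ℝ} : LocalLettersSplitTopStepCoreR F N Sup c B₃ C θ Q κ a₀ a₁ ↔
      LocalLettersSplitTopStepCoreGB F N Sup (floorGuard F c) (genSetDatum F) (dataSmall7PTopOf F N) (printedPlaqs0Of F) B₃ C θ Q κ a₀ a₁ :=
  Iff.rfl

/-- The same for the per-datum (165)-token. [cite: Balaban1985RegularSpaces, (1.3)–(1.6) p.77 (bookkeeping)] -/
theorem datumGauge165TopStepCoreR_iff_GB_floorGuard {Sup : (ν : Stage7Numerics) → (K : ℕ) → (ℕ → Set (Site (F.P K) 0)) → Set (Site (F.P K) 0)} {Mc ρ c : ℕ}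
    {B₃ C θ Q a₀ a₁ : ℝ} : DatumGauge165TopStepCoreR F N Sup Mc ρ c B₃ C θ Q a₀ a₁ ↔
      DatumGauge165TopStepCoreGB F N Sup Mc ρ (floorGuard F c) (genSetDatum F) (dataSmall7PTopOf F N) B₃ C θ Q a₀ a₁ :=
  Iff.rfl

/-- The same for the per-datum split token. [cite: Balaban1985RegularSpaces, (1.3)–(1.6) p.77 (bookkeeping)] -/
theorem datumGaugeSplitTopStepCoreR_iff_GB_floorGuard {Sup : (ν : Stage7Numerics) → (K : ℕ) → (ℕ → Set (Site (F.P K) 0)) → Set (Site (F.P K) 0)} {Mc ρ c : ℕ}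
    {B₃ C θ Q κ a₀ a₁ : ℝ} : DatumGaugeSplitTopStepCoreR F N Sup Mc ρ c B₃ C θ Q κ a₀ a₁ ↔
      DatumGaugeSplitTopStepCoreGB F N Sup Mc ρ (floorGuard F c) (genSetDatum F) (dataSmall7PTopOf F N) B₃ C θ Q κ a₀ a₁ :=
  Iff.rfl

end BridgesB

end Summit.QuantumFields.YangMills.BalabanUVNodes.N07LocalLettersCoreGuardedB

end
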